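import Mathlib.LinearAlgebra.Dimension.StrongRankCondition
import Mathlib.Tactic
import Summits.ValiantsHypothesis.ValiantsHypothesis.Theorems.GenericSubpermanents
import HarnessLib


/-!
# Row-partition (flattening) rank of the permanent: `per_n` is not a sum of fewer than `C(n,⌊n/2⌋)` products of row-local polynomials

**What is proved** (`choose_le_of_perPoly_eq_sum_prod_rowLocal`). Over a field `F`: if the generic
permanent `per_n ∈ F[x_{ij}]` is written as `Σ_{t < s} ∏_{i < n} q_{t,i}` where every factor
`q_{t,i}` mentions only the variables `x_{i,1}, …, x_{i,n}` of the row `i` (e.g. a linear form in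
them: a row-set-multilinear `ΣΠΣ` circuit of top fan-in `s`, `choose_le_of_perPoly_eq_depthThree`),
then `s ≥ C(n,k)` for every `k ≤ n`; hence `(n+1)·s ≥ 2^n` (`two_pow_le_succ_mul_of_rowLocal`).
BLOCK FORM (`choose_le_card_image_of_perPoly_eq_sum_mul_blockLocal`): if `per_n = Σ_{t < s} f_t · g_t`
with every `f_t` a polynomial in the rows `B` and every `g_t` in the other rows, then at least
`C(n,|B|)` DISTINCT `f_t` occur (the `B`-flattening rank of `per_n`) — the LEAF COUNT of any
row-block self-reduction of the permanent with block-local leaves: polynomially many leaves force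
blocks of `O(1)` rows, i.e. `Ω(n)` blocks, where the set-multilinearisation loss `4^(#blocks)` of the
lifting side `B_c` of `Theorems/SmThreshold.lean` is exponential (the dial is zero-sum for such
identities).

**Method** (Nisan–Wigderson's partial-derivative / flattening bound, run with SUBSTITUTIONS of
partial permutation matrices instead of derivatives, so that everything is an algebra map):
* `minorPer P J = Σ_{b : P ≃ J} ∏_{p ∈ P} x_{p, b p}`, the rectangular sub-permanents of the generic
  matrix (`GenericSubpermanents.minorPer_univ`);
* `matchSubst K M : x_{i,j} ↦ [j = M i]` on the rows `i ∈ K` sends `minorPer P J` to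
  `minorPer (P ∖ K) (J ∖ M(K))` (`matchSubst_minorPer`, by the row expansion
  `RyserTripartition.sum_equiv_prod_eq_sum_erase`), in particular `per_n` to the complementary
  sub-permanent (`matchSubst_perPoly`);
* the sub-permanents of a fixed format are LINEARLY INDEPENDENT (`linearIndependent_minorPer`): the
  0/1 point on the graph of a bijection `b₀ : P ≃ J` evaluates `minorPer P J` to `1` and every other
  `minorPer P' J'` with `|P'| = |P|`, `|J'| = |J|` to `0` (`eval_graphPt_self/other`);
* `matchSubst K M` fixes a factor local to a row outside `K` and turns a factor local to a row in `K`
  into a constant, so it maps `∏_i q_{t,i}` into the line through `∏_{i ∉ K} q_{t,i}`: the `C(n,k)²`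
  independent images of `per_n` lie in the span of `s·C(n,k)` partial products
  (`linearIndependent_le_span_aux'`).

Context: this is the depth-3 (more generally: `ΣΠ^{[n]}`-of-row-local) slice of the hardness side of
the threshold dial of `Theorems/SmThreshold.lean` — at top fan-in it is TRUE at every rate below
`2^n/(n+1)`. HONEST FRAMING: a classical restricted-model lower bound (flattening / partial-derivative
rank, Nisan–Wigderson 1996); nothing here bears on general circuits or on `VP ≠ VNP`, which is NOT
proved.

## References
* [NisanWigderson1996] N. Nisan, A. Wigderson, *Lower bounds on arithmetic circuits via partial
  derivatives*, Comput. Complexity 6 (1996/97) 217–234, §3 (partial-derivative dimension of the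
  determinant/permanent versus depth-3 circuits).
* [Ryser1963] H. J. Ryser, *Combinatorial Mathematics*, Carus Monograph 14, MAA 1963, Ch. 2 §5
  (sub-permanents, row expansion).
-/

-- layout Summits/ValiantsHypothesis/ValiantsHypothesis forces the duplicated namespace component
set_option linter.dupNamespace false

namespace Summit.ValiantsHypothesis.ValiantsHypothesis.Theorems.RowPartitionRank

open Finset MvPolynomial Literature.Computability.AlgebraicComplexity
open Summit.ValiantsHypothesis.ValiantsHypothesis.Theorems.GenericSubpermanents

noncomputable section


/-! ### The flattening bound: sums of products of row-local polynomials -/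

section Flattening

variable {F : Type*} [Field F]

/-- Constants substituted into a polynomial give a constant. [folklore] -/
theorem aeval_C_comp (n : ℕ) {σ : Type*} (v : σ → F) (g : MvPolynomial σ F) :
    aeval (fun j => (C (v j) : MvPolynomial (Fin n × Fin n) F)) g = C (eval v g) := by
  induction g using MvPolynomial.induction_on with
  | C a => simp
  | add p q hp hq => rw [map_add, map_add, hp, hq, C_add]
  | mul_X p j hp => rw [map_mul, map_mul, hp, aeval_X, eval_X, C_mul]

/-- The matching substitution FIXES a polynomial local to a row outside `K` (one mentioning only
that row's variables) … [folklore] -/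
theorem matchSubst_of_isRowLocal_of_not_mem (n : ℕ) {K : Finset (Fin n)} (M : Fin n → Fin n)
    {i : Fin n} (hi : i ∉ K) {q : MvPolynomial (Fin n × Fin n) F}
    (hq : ∃ g : MvPolynomial (Fin n) F, q = rename (Prod.mk i) g) :
    matchSubst (R := F) n K M q = q := by
  obtain ⟨g, rfl⟩ := hq
  unfold matchSubst
  rw [aeval_rename]
  have hφ : ((fun ij : Fin n × Fin n =>
      if ij.1 ∈ K then (if ij.2 = M ij.1 then (1 : MvPolynomial (Fin n × Fin n) F) else 0) else X ij) ∘
        Prod.mk i) = X ∘ Prod.mk i := by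
    funext j; simp [hi]
  rw [hφ, rename_eq_aeval]

/-- … and turns a polynomial local to a row inside `K` into a CONSTANT. [folklore] -/
theorem matchSubst_of_isRowLocal_of_mem (n : ℕ) {K : Finset (Fin n)} (M : Fin n → Fin n)
    {i : Fin n} (hi : i ∈ K) {q : MvPolynomial (Fin n × Fin n) F}
    (hq : ∃ g : MvPolynomial (Fin n) F, q = rename (Prod.mk i) g) :
    ∃ e : F, matchSubst (R := F) n K M q = C e := by
  classical
  obtain ⟨g, rfl⟩ := hq
  refine ⟨eval (fun j => if j = M i then 1 else 0) g, ?_⟩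
  unfold matchSubst
  rw [aeval_rename, ← aeval_C_comp]
  have hφ : ((fun ij : Fin n × Fin n =>
      if ij.1 ∈ K then (if ij.2 = M ij.1 then (1 : MvPolynomial (Fin n × Fin n) F) else 0) else X ij) ∘
        Prod.mk i) = fun j => C (if j = M i then (1 : F) else 0) := by
    funext j; simp [hi, apply_ite C]
  rw [hφ]

/-- **Row-partition (flattening) rank of the permanent.** If `per_n = Σ_{t < s} ∏_{i < n} q_{t,i}`
with every `q_{t,i}` local to the row `i`, i.e. of the form `rename (i, ·) g` (for instance a linear form in `x_{i,1}, …, x_{i,n}`: a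
row-set-multilinear `ΣΠΣ` circuit with top fan-in `s`), then `s ≥ C(n,k)` for every `k ≤ n`; in
particular `s ≥ C(n,⌊n/2⌋) ≥ 2^n/(n+1)`. Proof (partial-derivative / flattening method of
Nisan–Wigderson, with SUBSTITUTIONS of partial permutation matrices in place of derivatives): the
`C(n,k)²` substitutions `x_{K×·} ↦ 𝟙_{graph M}` (`|K| = |L| = k`, `M : K ≃ L`) send `per_n` to the
`C(n,k)²` linearly independent complementary sub-permanents (`matchSubst_perPoly`,
`linearIndependent_minorPer`), and send each product `∏_i q_{t,i}` into the span of the `C(n,k)`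
partial products `∏_{i ∉ K} q_{t,i}`; hence `C(n,k)² ≤ s·C(n,k)`.
[cite: NisanWigderson1996, Thm. 3.2 (method)] -/
theorem choose_le_of_perPoly_eq_sum_prod_rowLocal (n s k : ℕ) (hk : k ≤ n)
    (q : Fin s → Fin n → MvPolynomial (Fin n × Fin n) F)
    (hq : ∀ t i, ∃ g : MvPolynomial (Fin n) F, q t i = rename (Prod.mk i) g)
    (h : perPoly (Fin n) F = ∑ t, ∏ i, q t i) : n.choose k ≤ s := by
  classical
  -- the generators: partial products over row sets of size `n - k`
  let gen : Fin s → Finset (Fin n) → MvPolynomial (Fin n × Fin n) F := fun t Kc => ∏ i ∈ Kc, q t i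
  let G : Finset (MvPolynomial (Fin n × Fin n) F) :=
    univ.biUnion fun t => ((univ : Finset (Fin n)).powersetCard (n - k)).image (gen t)
  have hGcard : G.card ≤ s * n.choose k := by
    refine (card_biUnion_le).trans ?_
    have : ∀ t ∈ (univ : Finset (Fin s)),
        (((univ : Finset (Fin n)).powersetCard (n - k)).image (gen t)).card ≤ n.choose k := by
      intro t _
      refine card_image_le.trans ?_
      rw [card_powersetCard, card_univ, Fintype.card_fin, Nat.choose_symm hk]
    refine (sum_le_sum this).trans ?_
    simp
  -- the family: complementary sub-permanents indexed by pairs of `k`-sets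
  let I := {KL : Finset (Fin n) × Finset (Fin n) // KL.1.card = k ∧ KL.2.card = k}
  let v : I → MvPolynomial (Fin n × Fin n) F := fun KL => minorPer F n (univ \ KL.1.1) (univ \ KL.1.2)
  have hIcard : Fintype.card I = n.choose k * n.choose k := by
    rw [Fintype.card_congr (Equiv.subtypeProdEquivProd (p := fun K : Finset (Fin n) => K.card = k)
      (q := fun L : Finset (Fin n) => L.card = k)), Fintype.card_prod, Fintype.card_finset_len,
      Fintype.card_fin]
  -- `v` is linearly independent: it is the independent family of sub-permanents of format
  -- `(n-k) × (n-k)` composed with the injection `(K, L) ↦ (univ ∖ K, univ ∖ L)`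
  have hv : LinearIndependent F v := by
    let f : I → {PJ : Finset (Fin n) × Finset (Fin n) // PJ.1.card = n - k ∧ PJ.2.card = n - k} :=
      fun KL => ⟨(univ \ KL.1.1, univ \ KL.1.2), by
        constructor <;> simp [card_sdiff, KL.2.1, KL.2.2]⟩
    have hf : Function.Injective f := by
      rintro ⟨⟨K, L⟩, hK, hL⟩ ⟨⟨K', L'⟩, hK', hL'⟩ hKL
      simp only [f, Subtype.mk.injEq, Prod.mk.injEq] at hKL
      obtain ⟨h1, h2⟩ := hKL
      have e1 : K = K' := by
        simpa [sdiff_sdiff_right_self, inf_eq_inter, univ_inter] using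
          congrArg (fun A : Finset (Fin n) => univ \ A) h1
      have e2 : L = L' := by
        simpa [sdiff_sdiff_right_self, inf_eq_inter, univ_inter] using
          congrArg (fun A : Finset (Fin n) => univ \ A) h2
      subst e1; subst e2; rfl
    exact (linearIndependent_minorPer (F := F) n (n - k)).comp f hf
  -- every member of the family lies in the span of `G`
  have hrange : Set.range v ≤ Submodule.span F (G : Set (MvPolynomial (Fin n × Fin n) F)) := by
    rintro _ ⟨⟨⟨K, L⟩, hK, hL⟩, rfl⟩
    -- a bijection `K ≃ L` and the matching `M`
    have hcard : Fintype.card ↥K = Fintype.card ↥L := by simp [hK, hL]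
    let b : ↥K ≃ ↥L := Fintype.equivOfCardEq hcard
    let M : Fin n → Fin n := fun i => if hi : i ∈ K then ((b ⟨i, hi⟩ : ↥L) : Fin n) else i
    have hMinj : Set.InjOn M (K : Set (Fin n)) := by
      intro i hi i' hi' hii'
      have hi : i ∈ K := by simpa using hi
      have hi' : i' ∈ K := by simpa using hi'
      simp only [M, hi, hi', ↓reduceDIte] at hii'
      have := b.injective (Subtype.ext hii')
      simpa using this
    have hMimg : K.image M = L := by
      refine eq_of_subset_of_card_le (fun j hj => ?_) ?_
      · obtain ⟨i, hi, rfl⟩ := mem_image.mp hj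
        simp only [M, hi, ↓reduceDIte]
        exact (b ⟨i, hi⟩).2
      · rw [card_image_of_injOn hMinj, hK, hL]
    have hsub : matchSubst (R := F) n K M (perPoly (Fin n) F) = minorPer F n (univ \ K) (univ \ L) := by
      rw [matchSubst_perPoly (R := F) n K M hMinj, hMimg]
    show minorPer F n (univ \ K) (univ \ L) ∈ _
    rw [← hsub, h, map_sum]
    refine Submodule.sum_mem _ fun t _ => ?_
    rw [map_prod]
    -- split the product over `K` (constants) and `univ ∖ K` (fixed factors)
    have hconst : ∀ i ∈ K, ∃ e : F, matchSubst (R := F) n K M (q t i) = C e :=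
      fun i hi => matchSubst_of_isRowLocal_of_mem n M hi (hq t i)
    choose! e he using hconst
    rw [← prod_mul_prod_compl K]
    have h1 : ∏ i ∈ K, matchSubst (R := F) n K M (q t i) = C (∏ i ∈ K, e i) := by
      rw [map_prod]
      exact prod_congr rfl fun i hi => he i hi
    have h2 : ∏ i ∈ Kᶜ, matchSubst (R := F) n K M (q t i) = gen t Kᶜ :=
      prod_congr rfl fun i hi => matchSubst_of_isRowLocal_of_not_mem n M (mem_compl.mp hi) (hq t i)
    rw [h1, h2, ← smul_eq_C_mul]
    refine Submodule.smul_mem _ _ (Submodule.subset_span ?_)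
    rw [Finset.mem_coe]
    refine mem_biUnion.mpr ⟨t, mem_univ t, mem_image.mpr ⟨Kᶜ, ?_, rfl⟩⟩
    rw [mem_powersetCard]
    exact ⟨subset_univ _, by rw [card_compl, Fintype.card_fin, hK]⟩
  -- count
  have hle : Fintype.card I ≤ Fintype.card (G : Set (MvPolynomial (Fin n × Fin n) F)) :=
    linearIndependent_le_span_aux' v hv _ hrange
  rw [hIcard] at hle
  simp only [Finset.coe_sort_coe, Fintype.card_coe] at hle
  exact Nat.le_of_mul_le_mul_right (hle.trans hGcard) (Nat.choose_pos hk)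


/-- **Exponential form.** A sum of `s` products of row-local polynomials equal to `per_n` has
`(n+1)·s ≥ 2^n`. [cite: NisanWigderson1996, Thm. 3.2 (method)] -/
theorem two_pow_le_succ_mul_of_rowLocal (n s : ℕ)
    (q : Fin s → Fin n → MvPolynomial (Fin n × Fin n) F)
    (hq : ∀ t i, ∃ g : MvPolynomial (Fin n) F, q t i = rename (Prod.mk i) g)
    (h : perPoly (Fin n) F = ∑ t, ∏ i, q t i) : 2 ^ n ≤ (n + 1) * s := by
  -- the middle binomial coefficient is at least the average: `2^n ≤ (n+1)·C(n,⌊n/2⌋)`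
  -- (also `Theorems.ChowBorderBound.FanInTwoRung.two_pow_le_succ_mul_choose_middle`, in another cone)
  have hmid : 2 ^ n ≤ (n + 1) * n.choose (n / 2) := by
    rw [← Nat.sum_range_choose n]
    calc ∑ k ∈ range (n + 1), n.choose k ≤ ∑ k ∈ range (n + 1), n.choose (n / 2) :=
          sum_le_sum fun k _ => Nat.choose_le_middle k n
      _ = (n + 1) * n.choose (n / 2) := by simp
  exact hmid.trans (Nat.mul_le_mul_left _
    (choose_le_of_perPoly_eq_sum_prod_rowLocal n s (n / 2) (Nat.div_le_self n 2) q hq h))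

/-- **Depth three.** A row-set-multilinear `ΣΠΣ` expression for the permanent,
`per_n = Σ_{t < s} ∏_i (Σ_j a_{t,i,j} x_{i,j})`, has top fan-in `s ≥ C(n,k)` for every `k ≤ n`
(so `s ≥ 2^n/(n+1)`). [cite: NisanWigderson1996, Thm. 3.2 (method)] -/
theorem choose_le_of_perPoly_eq_depthThree (n s k : ℕ) (hk : k ≤ n) (a : Fin s → Fin n → Fin n → F)
    (h : perPoly (Fin n) F = ∑ t, ∏ i, ∑ j, C (a t i j) * X (i, j)) : n.choose k ≤ s := by
  refine choose_le_of_perPoly_eq_sum_prod_rowLocal n s k hk (fun t i => ∑ j, C (a t i j) * X (i, j))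
    (fun t i => ⟨∑ j, C (a t i j) * X j, ?_⟩) h
  simp [map_sum, rename_X]


/-! ### Block-local factorizations: the leaf count of a row-block self-reduction -/

/-- The matching substitution on the rows `K` FIXES a polynomial in the rows of a block `B` disjoint
from `K` … [folklore] -/
theorem matchSubst_of_blockLocal_of_disjoint (n : ℕ) {K B : Finset (Fin n)} (hKB : Disjoint K B)
    (M : Fin n → Fin n) {q : MvPolynomial (Fin n × Fin n) F}
    (hq : ∃ h : MvPolynomial {ij : Fin n × Fin n // ij.1 ∈ B} F, q = rename Subtype.val h) :
    matchSubst (R := F) n K M q = q := by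
  obtain ⟨g, rfl⟩ := hq
  unfold matchSubst
  rw [aeval_rename]
  have hφ : ((fun ij : Fin n × Fin n =>
      if ij.1 ∈ K then (if ij.2 = M ij.1 then (1 : MvPolynomial (Fin n × Fin n) F) else 0) else X ij) ∘
        (Subtype.val : {ij : Fin n × Fin n // ij.1 ∈ B} → Fin n × Fin n)) = X ∘ Subtype.val := by
    funext ij
    have : ij.1.1 ∉ K := fun hK => disjoint_left.mp hKB hK ij.2
    simp [this]
  rw [hφ, rename_eq_aeval]

/-- … and turns a polynomial in the rows of a block `B ⊆ K` into a CONSTANT. [folklore] -/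
theorem matchSubst_of_blockLocal_of_subset (n : ℕ) {K B : Finset (Fin n)} (hBK : B ⊆ K)
    (M : Fin n → Fin n) {q : MvPolynomial (Fin n × Fin n) F}
    (hq : ∃ h : MvPolynomial {ij : Fin n × Fin n // ij.1 ∈ B} F, q = rename Subtype.val h) :
    ∃ e : F, matchSubst (R := F) n K M q = C e := by
  classical
  obtain ⟨g, rfl⟩ := hq
  refine ⟨eval (fun ij : {ij : Fin n × Fin n // ij.1 ∈ B} => if ij.1.2 = M ij.1.1 then 1 else 0) g, ?_⟩
  unfold matchSubst
  rw [aeval_rename, ← aeval_C_comp n]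
  have hφ : ((fun ij : Fin n × Fin n =>
      if ij.1 ∈ K then (if ij.2 = M ij.1 then (1 : MvPolynomial (Fin n × Fin n) F) else 0) else X ij) ∘
        (Subtype.val : {ij : Fin n × Fin n // ij.1 ∈ B} → Fin n × Fin n)) =
      fun ij => C (if ij.1.2 = M ij.1.1 then (1 : F) else 0) := by
    funext ij
    simp [hBK ij.2, apply_ite C]
  rw [hφ]

/-- **Leaf count of a row-block self-reduction (the `B`-flattening rank of the permanent).** If
`per_n = Σ_{t < s} f_t · g_t` with every `f_t` a polynomial in the variables of the rows `B` and every
`g_t` a polynomial in the variables of the other rows, then at least `C(n,|B|)` DISTINCT factors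
`f_t` occur. (Substitute the partial permutation matrices `𝟙_{graph M}`, `M : Bᶜ ↪ [n]`, for the
rows outside `B`: `per_n` goes to the `C(n,|B|)` linearly independent sub-permanents `minorPer B L`,
each `f_t · g_t` to a scalar multiple of `f_t`.) CONSEQUENCE for the threshold dial of
`Theorems/SmThreshold.lean`: an identity expressing `per_n` through ROW-DISJOINT blocks with
block-local leaf polynomials (the shape of every block-Laplace / exact-cover self-reduction,
`Theorems/BlockLaplaceExpansion.lean`) feeds `≥ C(n,|B|)` distinct leaves to each block `B`; with
polynomially many leaves every block has `O(1)` (or `n − O(1)`) rows, hence there are `Ω(n)` blocks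
and the set-multilinearisation loss `4^(#blocks)` of `B_c` stays exponential — such identities cannot
drive the dial to `θ → 0`. [cite: NisanWigderson1996, Thm. 3.2 (method)] -/
theorem choose_le_card_image_of_perPoly_eq_sum_mul_blockLocal (n s : ℕ)
    [DecidableEq (MvPolynomial (Fin n × Fin n) F)] (B : Finset (Fin n))
    (f g : Fin s → MvPolynomial (Fin n × Fin n) F)
    (hf : ∀ t, ∃ h : MvPolynomial {ij : Fin n × Fin n // ij.1 ∈ B} F, f t = rename Subtype.val h)
    (hg : ∀ t, ∃ h : MvPolynomial {ij : Fin n × Fin n // ij.1 ∈ Bᶜ} F, g t = rename Subtype.val h)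
    (h : perPoly (Fin n) F = ∑ t, f t * g t) :
    n.choose B.card ≤ ((univ : Finset (Fin s)).image f).card := by
  classical
  -- the family of sub-permanents on the rows `B`
  let I := {L : Finset (Fin n) // L.card = B.card}
  let v : I → MvPolynomial (Fin n × Fin n) F := fun L => minorPer F n B L.1
  have hIcard : Fintype.card I = n.choose B.card := by
    rw [Fintype.card_finset_len, Fintype.card_fin]
  have hv : LinearIndependent F v := by
    let e : I → {PJ : Finset (Fin n) × Finset (Fin n) // PJ.1.card = B.card ∧ PJ.2.card = B.card} :=
      fun L => ⟨(B, L.1), rfl, L.2⟩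
    have he : Function.Injective e := by
      rintro ⟨L, hL⟩ ⟨L', hL'⟩ hLL'
      simp only [e, Subtype.mk.injEq, Prod.mk.injEq, true_and] at hLL'
      subst hLL'; rfl
    exact (linearIndependent_minorPer (F := F) n B.card).comp e he
  have hrange : Set.range v ≤
      Submodule.span F (((univ : Finset (Fin s)).image f : Finset _) : Set (MvPolynomial (Fin n × Fin n) F)) := by
    rintro _ ⟨⟨L, hL⟩, rfl⟩
    -- a bijection `Bᶜ ≃ Lᶜ` and the matching `M` on the rows outside `B`
    have hcard : Fintype.card ↥(Bᶜ) = Fintype.card ↥(Lᶜ) := by simp [hL]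
    let b : ↥(Bᶜ) ≃ ↥(Lᶜ) := Fintype.equivOfCardEq hcard
    let M : Fin n → Fin n := fun i => if hi : i ∈ Bᶜ then ((b ⟨i, hi⟩ : ↥(Lᶜ)) : Fin n) else i
    have hMinj : Set.InjOn M ((Bᶜ : Finset (Fin n)) : Set (Fin n)) := by
      intro i hi i' hi' hii'
      have hi : i ∈ Bᶜ := by simpa using hi
      have hi' : i' ∈ Bᶜ := by simpa using hi'
      simp only [M, hi, hi', ↓reduceDIte] at hii'
      have := b.injective (Subtype.ext hii')
      simpa using this
    have hMimg : (Bᶜ).image M = Lᶜ := by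
      refine eq_of_subset_of_card_le (fun j hj => ?_) ?_
      · obtain ⟨i, hi, rfl⟩ := mem_image.mp hj
        simp only [M, hi, ↓reduceDIte]
        exact (b ⟨i, hi⟩).2
      · rw [card_image_of_injOn hMinj, card_compl, card_compl, hL]
    have hsub : matchSubst (R := F) n (Bᶜ) M (perPoly (Fin n) F) = minorPer F n B L := by
      rw [matchSubst_perPoly (R := F) n (Bᶜ) M hMinj, hMimg, ← Finset.compl_eq_univ_sdiff,
        ← Finset.compl_eq_univ_sdiff, compl_compl, compl_compl]
    show minorPer F n B L ∈ _
    rw [← hsub, h, map_sum]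
    refine Submodule.sum_mem _ fun t _ => ?_
    obtain ⟨e, he⟩ := matchSubst_of_blockLocal_of_subset n (subset_refl (Bᶜ)) M (hg t)
    rw [map_mul, he, matchSubst_of_blockLocal_of_disjoint n disjoint_compl_left M (hf t), mul_comm,
      ← smul_eq_C_mul]
    refine Submodule.smul_mem _ _ (Submodule.subset_span ?_)
    rw [Finset.mem_coe]
    exact mem_image_of_mem f (mem_univ t)
  have hle := linearIndependent_le_span_aux' v hv _ hrange
  rw [hIcard] at hle
  simp only [Finset.coe_sort_coe, Fintype.card_coe] at hle
  exact hle

/-- In particular such a factorization has `s ≥ C(n,|B|)` summands. [cite: NisanWigderson1996, Thm. 3.2 (method)] -/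
theorem choose_le_of_perPoly_eq_sum_mul_blockLocal (n s : ℕ) (B : Finset (Fin n))
    (f g : Fin s → MvPolynomial (Fin n × Fin n) F)
    (hf : ∀ t, ∃ h : MvPolynomial {ij : Fin n × Fin n // ij.1 ∈ B} F, f t = rename Subtype.val h)
    (hg : ∀ t, ∃ h : MvPolynomial {ij : Fin n × Fin n // ij.1 ∈ Bᶜ} F, g t = rename Subtype.val h)
    (h : perPoly (Fin n) F = ∑ t, f t * g t) : n.choose B.card ≤ s :=
  by
  classical
  exact (choose_le_card_image_of_perPoly_eq_sum_mul_blockLocal n s B f g hf hg h).trans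
    (card_image_le.trans (by simp))

end Flattening

end

end Summit.ValiantsHypothesis.ValiantsHypothesis.Theorems.RowPartitionRank
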